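import Mathlib
import Summits.ValiantsHypothesis.ValiantsHypothesis.Theorems.GrenetZeonTwoDimCoefficientsDualUnipotentWildCore

/-!
# Crux `GrenetZeon.TwoDimCoefficients` (stmt-ValiantsHypothesis-8062), stub `stub_dualUnipotent`:
# the wild core, part 2 — the large irreducible block is GERSTENHABER-EXTREMAL up to the global slack

Part 1 (✓ `…DualUnipotentWildCore`, `exists_large_irreducible_block`) puts, for every unipotent-dual / trace-of-power
representation `per_n = tr(N^d·M)` of width `m`, an IRREDUCIBLE nilpotent constituent of matrix size `b > s` into the
Jordan–Hölder block form of the pencil whenever `2(m/s+1)·n + s·m < n²` (`b ≳ n²/m`).  This file prices the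
DIMENSION of that constituent from below, with the Gerstenhaber count run WITHOUT the level-flatness factor:

* `finrank_ker_top_le` — the top map `v ↦ N_lin(v)` has kernel of dimension `≤ 2n` (`per_n` is affine along it;
  ✓ `finrank_le_of_diagStill` with one level).
* `sq_le_card_offDiag_add_blockDims` — if the nilpotent space `W = ℂ·N(0) + N_lin(ℂ^{n×n})` is block upper
  triangular after `P` for `lvl` (`(P A P⁻¹)ᵢⱼ = 0` for `lvl i < lvl j`) and the `t`-th diagonal block space of the
  conjugated tops has dimension `≤ D t`, then `n² ≤ 2n + #{(i,j) : lvl j < lvl i} + Σ_{t<L} D t`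
  (rank–nullity for `v ↦ (off-diagonal-block entries, diagonal blocks)` of `P·N_lin(v)·P⁻¹`, whose kernel lies in
  the top kernel).
* ★ `sq_add_choose_le_wildBlock_finrank` — hence, for a NILPOTENT pencil and any level `t₀` of size `s₀`:
  `n² + C(s₀,2) ≤ 2n + #{(i,j) : lvl j < lvl i} + Σ_{t<L} C(b_t,2) + dim W_{t₀}` (Gerstenhaber ✓
  `finrank_le_choose_two` in every OTHER block).  Since `#{(i,j) : lvl j < lvl i} + Σ_t C(b_t,2) = C(m,2)`
  (`two_mul_card_offDiag_add_card_same`: `2·#off + #same = m²`), this reads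
  `dim W_{t₀} ≥ C(s₀,2) − σ`, `σ := C(m,2) + 2n − n² ≥ 0` the GERSTENHABER SLACK of the representation
  (✓ `two_mul_sq_le_of_dualUnipotentRepr`): at width `m = (√2 + η)·n` the large irreducible block of part 1
  (`s₀ ≳ n/√2`) is an irreducible nilpotent space of dimension `≥ (1 − 4√2·η − o(1))·C(s₀,2)`.
* `sq_add_choose_le_of_irreducible_bound` — the same with `dim W_{t₀}` replaced by any bound `β` valid for
  IRREDUCIBLE nilpotent subspaces of `M_{s₀}(ℂ)` (✓ `finrank_blockSpan_le`): the exact form in which a positive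
  answer to the Mathes–Omladič–Radjavi question (irreducible nilpotent spaces have dimension `≤ (1/2 − ε)s²`,
  Linear Algebra Appl. 149 (1991) §5 — OPEN, taken here only as an explicit hypothesis shape `β`) would push the
  stub's rung past `√2·n`; nothing is assumed.
* `exists_block_gt_quarter_of_dualUnipotentRepr` — numerics of part 1: `DualUnipotentRepr n m`, `n ≥ 64`,
  `m ≤ 2n` ⟹ an irreducible Jordan–Hölder block with more than `n/4` members.

HONEST FRAMING: unconditional structure/dimension bounds for the located open point of an ASIDE item; no stub, crux,
rung or `VP ≠ VNP` is proved.  No definitions, no named facts.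

References: M. Gerstenhaber, Amer. J. Math. 80 (1958), Thm. 1; B. Mathes, M. Omladič, H. Radjavi, Linear Algebra
Appl. 149 (1991) 215–225, §5.
-/

-- single-conjunct layout `Summits/ValiantsHypothesis/ValiantsHypothesis`: the duplicated namespace
-- component is mandated by the tree.
set_option linter.dupNamespace false
set_option autoImplicit false

noncomputable section

namespace Summit.ValiantsHypothesis.ValiantsHypothesis.Cruxes.TwoDimCoefficients.DimTwoCases

open MvPolynomial Matrix
open scoped BigOperators
open Literature.Computability.AlgebraicComplexity (perPoly)
open Summit.ValiantsHypothesis.ValiantsHypothesis.Theorems.GrenetZeon.RadicalSplit (linPart exists_topMap_linPart)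
open Summit.ValiantsHypothesis.ValiantsHypothesis.Theorems.GrenetZeon.HeavyTopInvariantFlag (linPart_eq_coeff)
open Summit.ValiantsHypothesis.ValiantsHypothesis.Theorems.GrenetZeon.HeavyTopCompositionBound
  (finrank_blockSpan_le)
open Literature.LinearAlgebra.Matrix.GerstenhaberNilpotentSubspace (finrank_le_choose_two)

variable {n m : ℕ}

/-! ### §1 The top kernel is flat -/

/-- **The top kernel is small.**  If `per_n = tr(N^d·M)` (`N`, `M` affine) then the kernel of the top map
`v ↦ N_lin(v)` has dimension `≤ 2n`: `per_n` is affine along it (level flatness with ONE level). [folklore] -/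
theorem finrank_ker_top_le {d : ℕ} (N M : AffMat n m) (hN : IsAffine N) (hM : IsAffine M)
    (hper : perPoly (Fin n) ℂ = (N ^ d * M).trace)
    (T : (Fin n × Fin n → ℂ) →ₗ[ℂ] Matrix (Fin m) (Fin m) ℂ) (hT : ∀ v, T v = linPart N v) :
    Module.finrank ℂ (LinearMap.ker T) ≤ 2 * n := by
  classical
  have h := finrank_le_of_diagStill (d := d) (g := 1) N M (fun _ => 0) (LinearMap.ker T) hN hM
    (fun i j hij => absurd hij (lt_irrefl _)) (fun u => Nat.zero_lt_one) hper ?_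
  · omega
  · intro v hv i j _
    have h0 : linPart N v = 0 := by rw [← hT]; exact LinearMap.mem_ker.1 hv
    have h1 := congr_fun (congr_fun h0 i) j
    rw [linPart_eq_coeff N hN v, Matrix.of_apply] at h1
    exact h1

/-! ### §2 The Gerstenhaber count in block form -/

set_option maxHeartbeats 800000 in
/-- **Block count without the flatness factor.**  `per_n = tr(N^d·M)`; the space `W = ℂ·N(0) + N_lin(ℂ^{n×n})`
block upper triangular after `P` for `lvl` with `L` levels; `t`-th diagonal block space of the conjugated tops of
dimension `≤ D t` ⟹ `n² ≤ 2n + #{(i,j) : lvl j < lvl i} + Σ_{t<L} D t`. [folklore] -/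
theorem sq_le_card_offDiag_add_blockDims {d : ℕ} (N M : AffMat n m) (hN : IsAffine N) (hM : IsAffine M)
    (hper : perPoly (Fin n) ℂ = (N ^ d * M).trace)
    (T : (Fin n × Fin n → ℂ) →ₗ[ℂ] Matrix (Fin m) (Fin m) ℂ) (hT : ∀ v, T v = linPart N v)
    (P : (Matrix (Fin m) (Fin m) ℂ)ˣ) (lvl : Fin m → ℕ) (L : ℕ) (hlvl : ∀ i, lvl i < L)
    (hPW : ∀ A ∈ (ℂ ∙ N.map (MvPolynomial.eval 0)) ⊔ LinearMap.range T, ∀ i j : Fin m, lvl i < lvl j →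
      ((P : Matrix (Fin m) (Fin m) ℂ) * A * (↑P⁻¹ : Matrix (Fin m) (Fin m) ℂ)) i j = 0)
    (D : ℕ → ℕ)
    (hD : ∀ t : Fin L, ∃ (s : ℕ) (e : {i : Fin m // lvl i = (t : ℕ)} ≃ Fin s),
      Module.finrank ℂ (Submodule.span ℂ (Set.range fun v : Fin n × Fin n → ℂ =>
        Matrix.reindex e e (((P : Matrix (Fin m) (Fin m) ℂ) * linPart N v * (↑P⁻¹ : Matrix (Fin m) (Fin m) ℂ)).toBlock
          (fun i => lvl i = (t : ℕ)) (fun i => lvl i = (t : ℕ))))) ≤ D t) :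
    n ^ 2 ≤ 2 * n + Fintype.card {q : Fin m × Fin m // lvl q.2 < lvl q.1} + ∑ t ∈ Finset.range L, D t := by
  classical
  -- the conjugated top map
  let T' : (Fin n × Fin n → ℂ) →ₗ[ℂ] Matrix (Fin m) (Fin m) ℂ :=
    (LinearMap.mulRight ℂ (↑P⁻¹ : Matrix (Fin m) (Fin m) ℂ)) ∘ₗ
      (LinearMap.mulLeft ℂ (P : Matrix (Fin m) (Fin m) ℂ)) ∘ₗ T
  have hT' : ∀ v, T' v = (P : Matrix (Fin m) (Fin m) ℂ) * linPart N v * (↑P⁻¹ : Matrix (Fin m) (Fin m) ℂ) := by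
    intro v
    simp only [T', LinearMap.coe_comp, Function.comp_apply, LinearMap.mulLeft_apply, LinearMap.mulRight_apply, hT]
  -- block maps
  choose sz e hsz using hD
  let blk : ∀ t : Fin L, Matrix (Fin m) (Fin m) ℂ →ₗ[ℂ] Matrix (Fin (sz t)) (Fin (sz t)) ℂ := fun t =>
    (Matrix.reindexAlgEquiv ℂ ℂ (e t)).toLinearEquiv.toLinearMap ∘ₗ
      { toFun := fun A => A.toBlock (fun i => lvl i = (t : ℕ)) (fun i => lvl i = (t : ℕ))
        map_add' := fun A B => rfl
        map_smul' := fun c A => rfl }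
  have hblk : ∀ (t : Fin L) (A : Matrix (Fin m) (Fin m) ℂ),
      blk t A = Matrix.reindexAlgEquiv ℂ ℂ (e t) (A.toBlock (fun i => lvl i = (t : ℕ)) (fun i => lvl i = (t : ℕ))) :=
    fun t A => rfl
  -- off-diagonal-block coordinates
  let off : Matrix (Fin m) (Fin m) ℂ →ₗ[ℂ] ({q : Fin m × Fin m // lvl q.2 < lvl q.1} → ℂ) :=
    { toFun := fun A q => A q.1.1 q.1.2
      map_add' := fun A B => rfl
      map_smul' := fun c A => rfl }
  let Φ : (Fin n × Fin n → ℂ) →ₗ[ℂ]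
      (({q : Fin m × Fin m // lvl q.2 < lvl q.1} → ℂ) × (∀ t : Fin L, Matrix (Fin (sz t)) (Fin (sz t)) ℂ)) :=
    LinearMap.prod (off ∘ₗ T') (LinearMap.pi fun t => blk t ∘ₗ T')
  have hΦ1 : ∀ v, (Φ v).1 = off (T' v) := fun v => rfl
  have hΦ2 : ∀ v t, (Φ v).2 t = blk t (T' v) := fun v t => rfl
  -- the kernel of `Φ` lies in the top kernel
  have hkerle : LinearMap.ker Φ ≤ LinearMap.ker T := by
    intro v hv
    rw [LinearMap.mem_ker] at hv ⊢
    have h1 : off (T' v) = 0 := by rw [← hΦ1, hv]; rfl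
    have h2 : ∀ t, blk t (T' v) = 0 := fun t => by rw [← hΦ2, hv]; rfl
    have hmem : T v ∈ (ℂ ∙ N.map (MvPolynomial.eval 0)) ⊔ LinearMap.range T :=
      Submodule.mem_sup_right (LinearMap.mem_range_self T v)
    have hzero : T' v = 0 := by
      ext i j
      rw [Matrix.zero_apply]
      rcases lt_trichotomy (lvl i) (lvl j) with hij | hij | hij
      · rw [hT', ← hT]
        exact hPW _ hmem i j hij
      · have hb := h2 ⟨lvl i, hlvl i⟩
        rw [hblk, map_eq_zero_iff _ (Matrix.reindexAlgEquiv ℂ ℂ _).injective] at hb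
        have h0 := congr_fun (congr_fun hb ⟨i, rfl⟩) ⟨j, hij.symm⟩
        rw [Matrix.toBlock_apply, Matrix.zero_apply] at h0
        exact h0
      · exact congr_fun h1 ⟨(i, j), hij⟩
    have hTv : T v = (↑P⁻¹ : Matrix (Fin m) (Fin m) ℂ) * T' v * (P : Matrix (Fin m) (Fin m) ℂ) := by
      rw [hT', ← hT, ← Matrix.mul_assoc, ← Matrix.mul_assoc, Units.inv_mul, Matrix.one_mul, Matrix.mul_assoc,
        Units.inv_mul, Matrix.mul_one]
    rw [hTv, hzero, Matrix.mul_zero, Matrix.zero_mul]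
  have hker : Module.finrank ℂ (LinearMap.ker Φ) ≤ 2 * n :=
    (Submodule.finrank_mono hkerle).trans (finrank_ker_top_le N M hN hM hper T hT)
  -- the block spaces are the spans of the statement
  have hDt : ∀ t : Fin L, Module.finrank ℂ (LinearMap.range (blk t ∘ₗ T')) ≤ D t := by
    intro t
    have hrg : LinearMap.range (blk t ∘ₗ T') = Submodule.span ℂ (Set.range fun v : Fin n × Fin n → ℂ =>
        Matrix.reindex (e t) (e t) (((P : Matrix (Fin m) (Fin m) ℂ) * linPart N v * (↑P⁻¹ : Matrix (Fin m) (Fin m) ℂ)).toBlock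
          (fun i => lvl i = (t : ℕ)) (fun i => lvl i = (t : ℕ)))) := by
      rw [← Submodule.span_eq (LinearMap.range _), LinearMap.coe_range]
      congr 1
      ext A
      simp only [Set.mem_range, LinearMap.comp_apply, hblk, Matrix.coe_reindexAlgEquiv, hT']
    rw [hrg]
    exact hsz t
  -- the range of `Φ` embeds into (off-diagonal coordinates) × Π (block spaces)
  have hrange : Module.finrank ℂ (LinearMap.range Φ) ≤
      Fintype.card {q : Fin m × Fin m // lvl q.2 < lvl q.1} + ∑ t : Fin L, D t := by
    let ι : LinearMap.range Φ →ₗ[ℂ]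
        (({q : Fin m × Fin m // lvl q.2 < lvl q.1} → ℂ) × (∀ t : Fin L, LinearMap.range (blk t ∘ₗ T'))) :=
      { toFun := fun x => (x.1.1, fun t => ⟨x.1.2 t, by
            obtain ⟨v, hv⟩ := LinearMap.mem_range.1 x.2
            exact LinearMap.mem_range.2 ⟨v, by rw [← hv]; rfl⟩⟩)
        map_add' := fun x y => rfl
        map_smul' := fun c x => rfl }
    have hι : Function.Injective ι := by
      intro x y hxy
      have h1 : x.1.1 = y.1.1 := by
        have h := congr_arg Prod.fst hxy
        exact h
      have h2 : ∀ t, x.1.2 t = y.1.2 t := fun t => by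
        have := congr_arg (fun f => ((f.2 t : LinearMap.range (blk t ∘ₗ T')) : Matrix (Fin (sz t)) (Fin (sz t)) ℂ))
          hxy
        exact this
      exact Subtype.ext (Prod.ext h1 (funext h2))
    calc Module.finrank ℂ (LinearMap.range Φ)
        ≤ Module.finrank ℂ (({q : Fin m × Fin m // lvl q.2 < lvl q.1} → ℂ) ×
            (∀ t : Fin L, LinearMap.range (blk t ∘ₗ T'))) :=
          LinearMap.finrank_le_finrank_of_injective hι
      _ = Fintype.card {q : Fin m × Fin m // lvl q.2 < lvl q.1} +
            ∑ t : Fin L, Module.finrank ℂ (LinearMap.range (blk t ∘ₗ T')) := by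
          rw [Module.finrank_prod, Module.finrank_fintype_fun_eq_card, Module.finrank_pi_fintype ℂ]
      _ ≤ Fintype.card {q : Fin m × Fin m // lvl q.2 < lvl q.1} + ∑ t : Fin L, D t :=
          Nat.add_le_add_left (Finset.sum_le_sum fun t _ => hDt t) _
  have hsum : ∑ t : Fin L, D t = ∑ t ∈ Finset.range L, D t := Fin.sum_univ_eq_sum_range (fun t => D t) L
  -- rank–nullity
  have h1 := LinearMap.finrank_range_add_finrank_ker Φ
  have h3 : Module.finrank ℂ (Fin n × Fin n → ℂ) = n * n := by
    rw [Module.finrank_fintype_fun_eq_card, Fintype.card_prod, Fintype.card_fin]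
  have h4 : n ^ 2 = n * n := sq n
  rw [← hsum]
  omega

/-- **Pair count.**  `2·#{(i,j) : lvl j < lvl i} + #{(i,j) : lvl i = lvl j} = m²` (swap the strict pairs; the
three kinds partition `Fin m × Fin m`).  With `#{lvl i = lvl j} = Σ_t b_t²` this is
`#{(i,j) : lvl j < lvl i} + Σ_t C(b_t,2) = C(m,2)`. [folklore] -/
theorem two_mul_card_offDiag_add_card_same (lvl : Fin m → ℕ) :
    2 * Fintype.card {q : Fin m × Fin m // lvl q.2 < lvl q.1} +
      Fintype.card {q : Fin m × Fin m // lvl q.1 = lvl q.2} = m ^ 2 := by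
  classical
  have hswap : Fintype.card {q : Fin m × Fin m // lvl q.2 < lvl q.1} =
      Fintype.card {q : Fin m × Fin m // lvl q.1 < lvl q.2} :=
    Fintype.card_congr ((Equiv.prodComm (Fin m) (Fin m)).subtypeEquiv fun q => Iff.rfl)
  have htot : (Finset.univ : Finset (Fin m × Fin m)).card = m ^ 2 := by
    rw [Finset.card_univ, Fintype.card_prod, Fintype.card_fin, sq]
  have hsplit : (Finset.univ.filter fun q : Fin m × Fin m => lvl q.2 < lvl q.1).card +
      (Finset.univ.filter fun q : Fin m × Fin m => lvl q.1 < lvl q.2).card +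
      (Finset.univ.filter fun q : Fin m × Fin m => lvl q.1 = lvl q.2).card =
      (Finset.univ : Finset (Fin m × Fin m)).card := by
    rw [← Finset.card_union_of_disjoint, ← Finset.card_union_of_disjoint]
    · congr 1
      ext q
      simp only [Finset.mem_union, Finset.mem_filter, Finset.mem_univ, true_and, iff_true]
      omega
    · exact Finset.disjoint_left.2 fun q hq hq' => by
        simp only [Finset.mem_union, Finset.mem_filter, Finset.mem_univ, true_and] at hq hq'
        omega
    · exact Finset.disjoint_left.2 fun q hq hq' => by
        simp only [Finset.mem_filter, Finset.mem_univ, true_and] at hq hq'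
        omega
  simp only [Fintype.card_subtype] at hswap ⊢
  omega

/-! ### §3 The large irreducible block is Gerstenhaber-extremal up to the slack -/

/-- ★ **Dimension of a block from below.**  `per_n = tr(N^d·M)` with `N` NILPOTENT (`N^m = 0`), `W` block upper
triangular after `P` for `lvl` with `L` levels, `t₀ < L` a level with `s₀` members.  Then
`n² + C(s₀,2) ≤ 2n + #{(i,j) : lvl j < lvl i} + Σ_{t<L} C(b_t,2) + dim W_{t₀}`, i.e.
`dim W_{t₀} ≥ C(s₀,2) − (C(m,2) + 2n − n²)`: the block is Gerstenhaber-extremal up to the global slack.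
[folklore + Gerstenhaber 1958 via the tree] -/
theorem sq_add_choose_le_wildBlock_finrank {d : ℕ} (N M : AffMat n m) (hN : IsAffine N) (hM : IsAffine M)
    (hnil : N ^ m = 0) (hper : perPoly (Fin n) ℂ = (N ^ d * M).trace)
    (T : (Fin n × Fin n → ℂ) →ₗ[ℂ] Matrix (Fin m) (Fin m) ℂ) (hT : ∀ v, T v = linPart N v)
    (P : (Matrix (Fin m) (Fin m) ℂ)ˣ) (lvl : Fin m → ℕ) (L : ℕ) (hlvl : ∀ i, lvl i < L)
    (hPW : ∀ A ∈ (ℂ ∙ N.map (MvPolynomial.eval 0)) ⊔ LinearMap.range T, ∀ i j : Fin m, lvl i < lvl j →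
      ((P : Matrix (Fin m) (Fin m) ℂ) * A * (↑P⁻¹ : Matrix (Fin m) (Fin m) ℂ)) i j = 0)
    (t₀ : Fin L) {s₀ : ℕ} (e₀ : {i : Fin m // lvl i = (t₀ : ℕ)} ≃ Fin s₀) :
    n ^ 2 + s₀.choose 2 ≤ 2 * n + Fintype.card {q : Fin m × Fin m // lvl q.2 < lvl q.1} +
      ∑ t ∈ Finset.range L, ((Finset.univ.filter fun i => lvl i = t).card).choose 2 +
      Module.finrank ℂ (Submodule.span ℂ (Set.range fun v : Fin n × Fin n → ℂ =>
        Matrix.reindex e₀ e₀ (((P : Matrix (Fin m) (Fin m) ℂ) * linPart N v * (↑P⁻¹ : Matrix (Fin m) (Fin m) ℂ)).toBlock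
          (fun i => lvl i = (t₀ : ℕ)) (fun i => lvl i = (t₀ : ℕ))))) := by
  classical
  set F₀ := Module.finrank ℂ (Submodule.span ℂ (Set.range fun v : Fin n × Fin n → ℂ =>
        Matrix.reindex e₀ e₀ (((P : Matrix (Fin m) (Fin m) ℂ) * linPart N v * (↑P⁻¹ : Matrix (Fin m) (Fin m) ℂ)).toBlock
          (fun i => lvl i = (t₀ : ℕ)) (fun i => lvl i = (t₀ : ℕ))))) with hF₀
  let D : ℕ → ℕ := fun t =>
    if t = (t₀ : ℕ) then F₀ else ((Finset.univ.filter fun i => lvl i = t).card).choose 2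
  have hD₀ : D (t₀ : ℕ) = F₀ := by simp [D]
  have hD : ∀ t : Fin L, ∃ (s : ℕ) (e : {i : Fin m // lvl i = (t : ℕ)} ≃ Fin s),
      Module.finrank ℂ (Submodule.span ℂ (Set.range fun v : Fin n × Fin n → ℂ =>
        Matrix.reindex e e (((P : Matrix (Fin m) (Fin m) ℂ) * linPart N v * (↑P⁻¹ : Matrix (Fin m) (Fin m) ℂ)).toBlock
          (fun i => lvl i = (t : ℕ)) (fun i => lvl i = (t : ℕ))))) ≤ D t := by
    intro t
    by_cases ht : (t : ℕ) = (t₀ : ℕ)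
    · rw [ht]
      exact ⟨s₀, e₀, le_of_eq hD₀.symm⟩
    · refine ⟨(Finset.univ.filter fun i => lvl i = (t : ℕ)).card,
        Fintype.equivFinOfCardEq (card_level_subtype lvl t), ?_⟩
      have h := finrank_blockSpan_le_choose_two N hN hnil T hT P lvl hPW t
        (Fintype.equivFinOfCardEq (card_level_subtype lvl t))
      have hDt : D t = ((Finset.univ.filter fun i => lvl i = (t : ℕ)).card).choose 2 := by
        simp only [D, if_neg ht]
      rw [hDt]
      exact h
  have hmain := sq_le_card_offDiag_add_blockDims N M hN hM hper T hT P lvl L hlvl hPW D hD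
  -- bookkeeping of the sums
  have ht₀ : (t₀ : ℕ) ∈ Finset.range L := Finset.mem_range.2 t₀.2
  have hsD : D (t₀ : ℕ) + ∑ t ∈ (Finset.range L).erase (t₀ : ℕ), D t = ∑ t ∈ Finset.range L, D t :=
    Finset.add_sum_erase _ _ ht₀
  have hsC : ((Finset.univ.filter fun i => lvl i = (t₀ : ℕ)).card).choose 2 +
      ∑ t ∈ (Finset.range L).erase (t₀ : ℕ), ((Finset.univ.filter fun i => lvl i = t).card).choose 2 =
      ∑ t ∈ Finset.range L, ((Finset.univ.filter fun i => lvl i = t).card).choose 2 :=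
    Finset.add_sum_erase (Finset.range L)
      (fun t => ((Finset.univ.filter fun i => lvl i = t).card).choose 2) ht₀
  have herase : ∑ t ∈ (Finset.range L).erase (t₀ : ℕ), D t =
      ∑ t ∈ (Finset.range L).erase (t₀ : ℕ), ((Finset.univ.filter fun i => lvl i = t).card).choose 2 :=
    Finset.sum_congr rfl fun t ht => by
      have hne : t ≠ (t₀ : ℕ) := Finset.ne_of_mem_erase ht
      simp only [D, if_neg hne]
  have hs₀ : s₀.choose 2 = ((Finset.univ.filter fun i => lvl i = (t₀ : ℕ)).card).choose 2 := by
    have h := Fintype.card_congr e₀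
    rw [Fintype.card_fin, card_level_subtype] at h
    rw [← h]
  omega

/-- **Conditional shape (nothing assumed).**  In the same setting, if the `t₀`-th block space acts IRREDUCIBLY
on `ℂ^{s₀}` (as supplied by ✓ `exists_large_irreducible_block`) and `β` bounds the dimension of every irreducible
nilpotent subspace of `M_{s₀}(ℂ)`, then `n² + C(s₀,2) ≤ 2n + #{(i,j) : lvl j < lvl i} + Σ_{t<L} C(b_t,2) + β`.
A positive answer `β ≤ (1/2 − ε)·s₀²` to the Mathes–Omladič–Radjavi question (OPEN; an explicit hypothesis here,
not a fact) would thus move the rung past `√2·n`. [folklore] -/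
theorem sq_add_choose_le_of_irreducible_bound {d : ℕ} (N M : AffMat n m) (hN : IsAffine N) (hM : IsAffine M)
    (hnil : N ^ m = 0) (hper : perPoly (Fin n) ℂ = (N ^ d * M).trace)
    (T : (Fin n × Fin n → ℂ) →ₗ[ℂ] Matrix (Fin m) (Fin m) ℂ) (hT : ∀ v, T v = linPart N v)
    (P : (Matrix (Fin m) (Fin m) ℂ)ˣ) (lvl : Fin m → ℕ) (L : ℕ) (hlvl : ∀ i, lvl i < L)
    (hPW : ∀ A ∈ (ℂ ∙ N.map (MvPolynomial.eval 0)) ⊔ LinearMap.range T, ∀ i j : Fin m, lvl i < lvl j →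
      ((P : Matrix (Fin m) (Fin m) ℂ) * A * (↑P⁻¹ : Matrix (Fin m) (Fin m) ℂ)) i j = 0)
    (t₀ : Fin L) {s₀ : ℕ} (e₀ : {i : Fin m // lvl i = (t₀ : ℕ)} ≃ Fin s₀) (β : ℕ)
    (hβ : ∀ V : Submodule ℂ (Matrix (Fin s₀) (Fin s₀) ℂ), (∀ B ∈ V, IsNilpotent B) →
      (∀ U : Submodule ℂ (Fin s₀ → ℂ), (∀ B ∈ V, ∀ x ∈ U, B *ᵥ x ∈ U) → U = ⊥ ∨ U = ⊤) →
      Module.finrank ℂ V ≤ β)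
    (hirr : ∀ U : Submodule ℂ (Fin s₀ → ℂ),
      (∀ A ∈ (ℂ ∙ N.map (MvPolynomial.eval 0)) ⊔ LinearMap.range T, ∀ x ∈ U,
        Matrix.reindex e₀ e₀ ((((P : Matrix (Fin m) (Fin m) ℂ) * A * (↑P⁻¹ : Matrix (Fin m) (Fin m) ℂ)).toBlock
          (fun i => lvl i = (t₀ : ℕ)) (fun i => lvl i = (t₀ : ℕ)))) *ᵥ x ∈ U) → U = ⊥ ∨ U = ⊤) :
    n ^ 2 + s₀.choose 2 ≤ 2 * n + Fintype.card {q : Fin m × Fin m // lvl q.2 < lvl q.1} +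
      ∑ t ∈ Finset.range L, ((Finset.univ.filter fun i => lvl i = t).card).choose 2 + β := by
  have h1 := sq_add_choose_le_wildBlock_finrank N M hN hM hnil hper T hT P lvl L hlvl hPW t₀ e₀
  have h2 := finrank_blockSpan_le N hN hnil T hT P lvl hPW (t₀ : ℕ) e₀ β hβ hirr
  omega

/-! ### §4 Numerics of the wild core -/

/-- **Numerical corollary (how large the wild block is).**  If `DualUnipotentRepr n m` with `n ≥ 64` and
`m ≤ 2n` (twice the permanent's size — above Gerstenhaber's `√2·n`, ✓ `two_mul_sq_le_of_dualUnipotentRepr`), then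
the Jordan–Hölder block form of the normal-form pencil has an IRREDUCIBLE diagonal block with more than `n/4`
members (`s = n/4` satisfies `2(m/s+1)·n + s·m ≤ 24n + n²/2 < n²`). [folklore] -/
theorem exists_block_gt_quarter_of_dualUnipotentRepr (hn : 64 ≤ n) (h : DualUnipotentRepr n m) (hm : m ≤ 2 * n) :
    ∃ N M : AffMat n m, IsAffine N ∧ IsAffine M ∧ N ^ m = 0 ∧
      perPoly (Fin n) ℂ = (N ^ (n - 1) * M).trace ∧
    ∃ (T : (Fin n × Fin n → ℂ) →ₗ[ℂ] Matrix (Fin m) (Fin m) ℂ), (∀ v, T v = linPart N v) ∧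
    ∃ (P : (Matrix (Fin m) (Fin m) ℂ)ˣ) (L : ℕ) (lvl : Fin m → ℕ),
      (∀ i, lvl i < L) ∧
      (∀ A ∈ (ℂ ∙ N.map (MvPolynomial.eval 0)) ⊔ LinearMap.range T, ∀ i j : Fin m, lvl i < lvl j →
        ((P : Matrix (Fin m) (Fin m) ℂ) * A * (↑P⁻¹ : Matrix (Fin m) (Fin m) ℂ)) i j = 0) ∧
      (∀ t, t < L → ∀ (s : ℕ) (e : {i : Fin m // lvl i = t} ≃ Fin s) (U : Submodule ℂ (Fin s → ℂ)),
        (∀ A ∈ (ℂ ∙ N.map (MvPolynomial.eval 0)) ⊔ LinearMap.range T, ∀ x ∈ U,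
          (Matrix.reindex e e (((P : Matrix (Fin m) (Fin m) ℂ) * A * (↑P⁻¹ : Matrix (Fin m) (Fin m) ℂ)).toBlock
            (fun i => lvl i = t) (fun i => lvl i = t))) *ᵥ x ∈ U) →
        U = ⊥ ∨ U = ⊤) ∧
      ∃ t, t < L ∧ n / 4 < (Finset.univ.filter fun i => lvl i = t).card := by
  obtain ⟨N, M, hN, hM, hnil, hper, T, hT, P, L, lvl, hlvl, -, -, hPW, hirr, -, hbig⟩ :=
    exists_large_irreducible_block_of_dualUnipotentRepr (by omega) h
  refine ⟨N, M, hN, hM, hnil, hper, T, hT, P, L, lvl, hlvl, hPW, hirr, hbig (n / 4) (by omega) ?_⟩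
  -- `2(m/(n/4) + 1)·n + (n/4)·m < n²` for `m ≤ 2n`, `n ≥ 64`
  have hq : m / (n / 4) ≤ 11 := by
    apply Nat.le_of_lt_succ
    rw [Nat.div_lt_iff_lt_mul (by omega)]
    omega
  have h1 : 2 * (m / (n / 4) + 1) * n ≤ 24 * n := by nlinarith
  have h2 : n / 4 * m ≤ n / 4 * (2 * n) := Nat.mul_le_mul_left _ hm
  have h3 : 4 * (n / 4) ≤ n := Nat.mul_div_le n 4
  nlinarith

end Summit.ValiantsHypothesis.ValiantsHypothesis.Cruxes.TwoDimCoefficients.DimTwoCases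

end
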